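import Literature.Geometry.Kaehler.ComplexTorusCorrespondenceRingHOneNaturality
import HarnessLib

/-!
# Poincaré duality of the Künneth corners in the ring of correspondences of a complex torus: the transpose
# carries the corner `π_s ∘ B^g(X × X)` onto `π_{2g-s} ∘ B^g(X × X)` (and likewise for `H^{2g}(X × X, ℚ)` and for
# the whole ring), and the covariant weight-one realisation `B ↦ ᵗ(h¹(B))` of `End_ℚ(X)` has image exactly the
# top odd corner `π_{2g-1} ∘ B^g(X × X)` — every Hodge class there is a `ℚ`-combination of classes `π_{2g-1} ∘ [Γ_α]`

Layer `Literature/Geometry/Kaehler`, namespace `Literature.Geometry.Kaehler.ComplexTorus.CorrRing`; lane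
`lit-hodgefound` (Track 2 foundations library), Layer A4; prover seat `lit-hodgefound-p08`, generation 17, row g17-#7
(claimed in the lane INBOX 2026-08-23). Sequel of g17-#3 (`hOneRat`, `range_hOneRat`) and g17-#4 (`transpose_hOne`),
CONSUMING BY NAME, nothing restated: Q1483 (`transpose`, `transpose_mul`, `transpose_transpose`, `transpose_mem_hodgeCorr`,
`transpose_mem_ratCorr`, `hodgeCorr`, `ratCorr`), Q1562 (`kunnethIdem`, `transpose_kunnethIdem`, `commute_kunnethIdem`),
g15-#2 (`graphCorr`), g17-#3 (`hOne`, `hOneRat`, `range_hOneRat`, `coe_hOneRat_map_intCast`), g17-#4 (`transpose_hOne`).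

## Sources, verbatim

* H. Lange, *Abelian Varieties over the Complex Numbers* (Springer 2023), §6.3.4 Prop. 6.3.10 p. 318 (held text
  `book:lange1992-complex-abelian-varieties`): `ᵗπ_s = π_{2g-s}` (the Künneth decomposition is self-dual under the
  transpose); §6.2.2 p0304 L11–L13: "It induces an isomorphism `Ch(X₂ × X₁) → Ch(X₁ × X₂)`, `Z ↦ ᵗZ := s^*Z`".
* W. Fulton, *Intersection Theory* (2nd ed. 1998), §16.1 Prop. 16.1.1 (b) (`ᵗ(β ∘ α) = ᵗα ∘ ᵗβ`), Example 16.1.15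
  (`Hⁿ(X × X) ≅ ⊕ᵢ Hom(HⁱX, HⁱX)`), held text `book:fultonnd-intersection-theory` p0295, p0302.
* B. Kahn, *Zeta and L-Functions of Varieties and Motives* (CUP 2020), §6.11 Thm. 6.37 (p0127–p0128): `h¹` is fully
  faithful on `Ab⁰(k)`; P. Deligne, J. S. Milne, *Tannakian categories* (LNM 900), §6 Prop. 6.21 (a).

## What is proved (torus level, `X = E/Φ(ℤ^ι)` of dimension `g`, `π_s = kunnethIdem s`, `B^g = hodgeCorr`, `H(ℚ) = ratCorr`)

* §1 `transpose_kunnethIdem_mul` **`ᵗ(π_s ∘ u) = π_{2g-s} ∘ ᵗu`** (`s ≤ 2g`), `transpose_mul_kunnethIdem`;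
  **`image_transpose_kunnethIdem_mul_hodgeCorr`: `ᵗ(π_s ∘ B^g) = π_{2g-s} ∘ B^g`**, `image_transpose_kunnethIdem_mul_ratCorr`
  (`ᵗ(π_s ∘ H(ℚ)) = π_{2g-s} ∘ H(ℚ)`), `image_transpose_kunnethIdem_mul` (`ᵗ(π_s ∘ C(X)) = π_{2g-s} ∘ C(X)`): the
  transpose is a bijection between opposite corners (Poincaré duality `Hˢ ≅ (H^{2g-s})^∨` at the level of the
  endomorphism corners `Hom(Hˢ, Hˢ) ↔ Hom(H^{2g-s}, H^{2g-s})`).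
* §2 **THE COVARIANT WEIGHT-ONE CORNER IS FULL TOO**: `range_transpose_hOneRat`
  **`{ᵗ(h¹(B)) : B ∈ End_ℚ(X)} = π_{2g-1} ∘ B^g(X × X)`** (g17-#3 `range_hOneRat` transposed): every Hodge class in the
  top odd corner is a `ℚ`-combination of the classes `π_{2g-1} ∘ [Γ_α] = ᵗ(h¹(α))` (`transpose_coe_hOneRat_map_intCast`),
  and `transpose ∘ hOneRat` is injective (`transpose_hOneRat_injective`) — the covariant realisation `h₁ ⊗ ℚ` of
  `End_ℚ(X)` is an isomorphism onto the corner `π_{2g-1} ∘ B^g ∘ π_{2g-1}`.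

Theorems only; NO definition, NO named fact, net Literature debt 0.

## References

* [Lange2023AbelianVarietiesComplex] H. Lange, *Abelian Varieties over the Complex Numbers*, Springer (2023), §6.2.2
  (p. 304), §6.3.4 Prop. 6.3.10.
* [Fulton1998] W. Fulton, *Intersection Theory*, 2nd ed., Springer (1998), §16.1 Prop. 16.1.1 (b), Example 16.1.15.
* [Kahn2020] B. Kahn, *Zeta and L-Functions of Varieties and Motives*, LMS LN 462, CUP (2020), §6.11 Thm. 6.37.
* [DeligneMilne1982Tannakian] P. Deligne, J. S. Milne, *Tannakian categories*, LNM 900, Springer (1982), §6 Prop. 6.21.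
-/

noncomputable section

-- Nested instance problems on the carriers (as in the sibling files).
set_option maxSynthPendingDepth 3

open scoped Manifold Matrix
open Set Function Module MulOpposite

universe u

namespace Literature.Geometry.Kaehler

namespace ComplexTorus

namespace CorrRing

section OneTorus

variable {ι : Type*} [Fintype ι] [DecidableEq ι] {E : Type u} [NormedAddCommGroup E] [NormedSpace ℂ E]
  (Φ : (ι → ℝ) ≃L[ℝ] E) {g : ℕ} (e : Fin (g + g) ≃ ι) (he : orientationSign Φ e = 1)
  (e' : Fin ((g + g) + (g + g)) ≃ ι ⊕ ι)

/-! ## §1 The transpose exchanges the corners `π_s` and `π_{2g-s}` -/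

/-- **`ᵗ(π_s ∘ u) = π_{2g-s} ∘ ᵗu`** for `s ≤ 2g` (`ᵗ(a ∘ b) = ᵗb ∘ ᵗa`, `ᵗπ_s = π_{2g-s}`, `π_{2g-s}` central).
[cite: Lange2023AbelianVarietiesComplex, §6.3.4 Prop. 6.3.10] [cite: Fulton1998, §16.1 Prop. 16.1.1 (b)] -/
theorem transpose_kunnethIdem_mul (s : ℕ) (hs : s ≤ g + g) (u : CorrRing Φ e he e') :
    transpose Φ e he e' (kunnethIdem Φ e he e' s * u) =
      kunnethIdem Φ e he e' (g + g - s) * transpose Φ e he e' u := by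
  rw [transpose_mul, transpose_kunnethIdem Φ e he e' s (g + g - s) (Nat.add_sub_of_le hs)]
  exact ((commute_kunnethIdem Φ e he e' (g + g - s) _).eq).symm

/-- `ᵗ(u ∘ π_s) = ᵗu ∘ π_{2g-s}`. [cite: Lange2023AbelianVarietiesComplex, §6.3.4 Prop. 6.3.10] [cite: Fulton1998, §16.1 Prop. 16.1.1 (b)] -/
theorem transpose_mul_kunnethIdem (s : ℕ) (hs : s ≤ g + g) (u : CorrRing Φ e he e') :
    transpose Φ e he e' (u * kunnethIdem Φ e he e' s) =
      transpose Φ e he e' u * kunnethIdem Φ e he e' (g + g - s) := by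
  rw [transpose_mul, transpose_kunnethIdem Φ e he e' s (g + g - s) (Nat.add_sub_of_le hs)]
  exact (commute_kunnethIdem Φ e he e' (g + g - s) _).eq

/-- The transpose maps the corner `π_s ∘ S` onto `π_{2g-s} ∘ S` for every transpose-stable set `S` of
correspondences. [cite: Lange2023AbelianVarietiesComplex, §6.3.4 Prop. 6.3.10 and §6.2.2 p. 304] -/
theorem image_transpose_kunnethIdem_mul_of_forall (S : Set (CorrRing Φ e he e'))
    (hS : ∀ a ∈ S, transpose Φ e he e' a ∈ S) (s : ℕ) (hs : s ≤ g + g) :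
    transpose Φ e he e' '' ((fun u ↦ kunnethIdem Φ e he e' s * u) '' S) =
      (fun u ↦ kunnethIdem Φ e he e' (g + g - s) * u) '' S := by
  ext w
  simp only [Set.mem_image]
  constructor
  · rintro ⟨v, ⟨u, hu, rfl⟩, rfl⟩
    exact ⟨_, hS u hu, (transpose_kunnethIdem_mul Φ e he e' s hs u).symm⟩
  · rintro ⟨u, hu, rfl⟩
    refine ⟨kunnethIdem Φ e he e' s * transpose Φ e he e' u, ⟨_, hS u hu, rfl⟩, ?_⟩
    rw [transpose_kunnethIdem_mul Φ e he e' s hs, transpose_transpose]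

/-- **`ᵗ(π_s ∘ B^g(X × X)) = π_{2g-s} ∘ B^g(X × X)`**: the transpose is a bijection between the opposite corners of
the algebra of Hodge correspondences (`B^g` is transpose-stable). [cite: Lange2023AbelianVarietiesComplex, §6.3.4 Prop. 6.3.10 and §6.2.1 Lemma 6.2.7]
[cite: Fulton1998, Example 16.1.15] -/
theorem image_transpose_kunnethIdem_mul_hodgeCorr (s : ℕ) (hs : s ≤ g + g) :
    transpose Φ e he e' ''
        ((fun u ↦ kunnethIdem Φ e he e' s * u) '' (hodgeCorr Φ e he e' : Set (CorrRing Φ e he e'))) =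
      (fun u ↦ kunnethIdem Φ e he e' (g + g - s) * u) '' (hodgeCorr Φ e he e' : Set (CorrRing Φ e he e')) :=
  image_transpose_kunnethIdem_mul_of_forall Φ e he e' _ (fun _ ha ↦ transpose_mem_hodgeCorr Φ e he e' ha) s hs

/-- **`ᵗ(π_s ∘ H^{2g}(X × X, ℚ)) = π_{2g-s} ∘ H^{2g}(X × X, ℚ)`.** [cite: Lange2023AbelianVarietiesComplex, §6.3.4 Prop. 6.3.10]
[cite: Fulton1998, Example 16.1.15] -/
theorem image_transpose_kunnethIdem_mul_ratCorr (s : ℕ) (hs : s ≤ g + g) :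
    transpose Φ e he e' ''
        ((fun u ↦ kunnethIdem Φ e he e' s * u) '' (ratCorr Φ e he e' : Set (CorrRing Φ e he e'))) =
      (fun u ↦ kunnethIdem Φ e he e' (g + g - s) * u) '' (ratCorr Φ e he e' : Set (CorrRing Φ e he e')) :=
  image_transpose_kunnethIdem_mul_of_forall Φ e he e' _ (fun _ ha ↦ transpose_mem_ratCorr Φ e he e' ha) s hs

/-- **`ᵗ(π_s ∘ C(X)) = π_{2g-s} ∘ C(X)`** (the corners `Hom(H^{2g-s}, H^{2g-s})` and `Hom(Hˢ, Hˢ)` of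
`H^{2g}(X × X) ≅ ⊕ᵢ Hom(HⁱX, HⁱX)` are exchanged). [cite: Fulton1998, Example 16.1.15] [cite: Lange2023AbelianVarietiesComplex, §6.3.4 Prop. 6.3.10] -/
theorem image_transpose_kunnethIdem_mul (s : ℕ) (hs : s ≤ g + g) :
    transpose Φ e he e' '' Set.range (fun u : CorrRing Φ e he e' ↦ kunnethIdem Φ e he e' s * u) =
      Set.range (fun u : CorrRing Φ e he e' ↦ kunnethIdem Φ e he e' (g + g - s) * u) := by
  rw [← Set.image_univ, ← Set.image_univ]
  exact image_transpose_kunnethIdem_mul_of_forall Φ e he e' _ (fun _ _ ↦ Set.mem_univ _) s hs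

/-! ## §2 The covariant weight-one corner: `{ᵗ(h¹(B))} = π_{2g-1} ∘ B^g(X × X)` -/

section Rat

variable (h1 : 1 ≤ g + g)

/-- **`{ᵗ(h¹(B)) : B ∈ End_ℚ(X)} = π_{2g-1} ∘ B^g(X × X)`**: the covariant weight-one realisation of `End_ℚ(X)`
(`B ↦ ᵗ(h¹(B))`, on `End(X)`: `α ↦ π_{2g-1} ∘ [Γ_α]`) has image EXACTLY the top odd corner of the algebra of Hodge
correspondences (g17-#3 `range_hOneRat` — "`h¹` is fully faithful" — transposed, §1).
[cite: Kahn2020, §6.11 Thm. 6.37] [cite: DeligneMilne1982Tannakian, §6 Prop. 6.21 (a)] [cite: Lange2023AbelianVarietiesComplex, §6.3.4 Prop. 6.3.10] -/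
theorem range_transpose_hOneRat :
    Set.range (fun B : (endAlgRat Φ)ᵐᵒᵖ ↦ transpose Φ e he e' (hOneRat Φ e he e' h1 B : CorrRing Φ e he e')) =
      (fun u ↦ kunnethIdem Φ e he e' (g + g - 1) * u) '' (hodgeCorr Φ e he e' : Set (CorrRing Φ e he e')) := by
  rw [show (fun B : (endAlgRat Φ)ᵐᵒᵖ ↦ transpose Φ e he e' (hOneRat Φ e he e' h1 B : CorrRing Φ e he e')) =
      transpose Φ e he e' ∘ (fun B : (endAlgRat Φ)ᵐᵒᵖ ↦ (hOneRat Φ e he e' h1 B : CorrRing Φ e he e')) from rfl,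
    Set.range_comp, range_hOneRat, image_transpose_kunnethIdem_mul_hodgeCorr Φ e he e' 1 h1]

/-- **`ᵗ(h¹(α ⊗ 1)) = π_{2g-1} ∘ [Γ_α]`** for `α ∈ End(X)`: on integral endomorphisms the covariant realisation is the
top odd corner of the graph (g17-#3 `coe_hOneRat_map_intCast`, g17-#4 `transpose_hOne`). [cite: Kahn2020, §6.11 Thm. 6.37]
[cite: Lange2023AbelianVarietiesComplex, §6.3.4 Prop. 6.3.10] -/
theorem transpose_coe_hOneRat_map_intCast (A : endRingInt Φ) :
    transpose Φ e he e'
        (hOneRat Φ e he e' h1 (op ⟨(A : Matrix ι ι ℤ).map (Int.cast : ℤ → ℚ), (mem_endRingInt_iff Φ).1 A.2⟩) :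
          CorrRing Φ e he e') =
      kunnethIdem Φ e he e' (g + g - 1) * graphCorr Φ e he e' A := by
  rw [coe_hOneRat_map_intCast, transpose_hOne Φ e he e' h1, MulOpposite.unop_op]

/-- **Every Hodge class in the corner `π_{2g-1} ∘ B^g(X × X)` is `ᵗ(h¹(B))` for a unique `B ∈ End_ℚ(X)`**
(existence). [cite: Kahn2020, §6.11 Thm. 6.37] [cite: DeligneMilne1982Tannakian, §6 Prop. 6.21 (a)] -/
theorem kunnethIdem_top_mul_mem_range_transpose_hOneRat {u : CorrRing Φ e he e'} (hu : u ∈ hodgeCorr Φ e he e') :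
    kunnethIdem Φ e he e' (g + g - 1) * u ∈
      Set.range (fun B : (endAlgRat Φ)ᵐᵒᵖ ↦ transpose Φ e he e' (hOneRat Φ e he e' h1 B : CorrRing Φ e he e')) := by
  rw [range_transpose_hOneRat]
  exact ⟨u, hu, rfl⟩

/-- `B ↦ ᵗ(h¹(B))` is injective (uniqueness; `ᵗ` is an involution, `hOneRat` is injective).
[cite: Kahn2020, §6.11 Thm. 6.37] [cite: DeligneMilne1982Tannakian, §6 Thm. 6.20] -/
theorem transpose_hOneRat_injective :
    Injective (fun B : (endAlgRat Φ)ᵐᵒᵖ ↦ transpose Φ e he e' (hOneRat Φ e he e' h1 B : CorrRing Φ e he e')) := by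
  intro B C hBC
  have h := congrArg (transpose Φ e he e') hBC
  simp only [transpose_transpose] at h
  exact hOneRat_injective Φ e he e' h1 (Subtype.ext h)

/-- **`B ↦ ᵗ(h¹(B))` is MULTIPLICATIVE in the given order** (covariant: `ᵗ(h¹(C B)) = ᵗ(h¹(B) ∘ h¹(C)) =
ᵗh¹(C) ∘ ᵗh¹(B)`) — the covariant functor `h₁` on `End_ℚ(X)`. [cite: Kahn2020, §6.11 Thm. 6.37] [cite: Fulton1998, §16.1 Prop. 16.1.1 (b)] -/
theorem transpose_hOneRat_mul (B C : endAlgRat Φ) :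
    transpose Φ e he e' (hOneRat Φ e he e' h1 (op (C * B)) : CorrRing Φ e he e') =
      transpose Φ e he e' (hOneRat Φ e he e' h1 (op C) : CorrRing Φ e he e') *
        transpose Φ e he e' (hOneRat Φ e he e' h1 (op B) : CorrRing Φ e he e') := by
  rw [op_mul, map_mul, Subalgebra.coe_mul, transpose_mul]

end Rat

end OneTorus

end CorrRing

end ComplexTorus

end Literature.Geometry.Kaehler

end
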